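/-
Copyright: the b2b-balaban T⁴-continuum CRUX team, row NE7b OWNER lineage `t4-ne7b-p1` (gen 141). Project licence.
-/
import Summits.QuantumFields.BalabanUV.T4Continuum.Spine.NE7b.SupWhitenedThirdKernelLetter

/-!
# THE THIRD-CUMULANT ENTRY OF THE FLUCTUATION STEP, GENERAL `Γ = AAᵀ`, ANY ADMISSIBLE `D` (SCOPING (d13)(1), second file): the
# background-free ENTRY majorant behind (468)'s row letter.  For the gradient components `F_v = U′(Aξ+ψ)[e_v]` tilted against `N(0,AAᵀ)` in
# whitened coordinates, ANY `D ≥ 0` with `δ + D·C ≤ D` (`C = HA∕(1−lamA)` off the diagonal) carrying the WEIGHTED letters `Σ_wD_{zw}θ_{zw} ≤ dθ`,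
# `Σ_zD_{zw}θ_{zw} ≤ dθ′` (a sampler weight `θ ≥ 0`, a compatible cross weight `σ`, a symmetric submultiplicative site weight `ρ ≥ 1` with
# `ρ⁸ ≤ σσ`, the observables' weighted profiles `αθ, βθ`) gives, by (467) at the three vertices, (466)'s decay of `B` and (463)'s tree lemma,
#   `|E_ν(F_x − EF_x)(F_y − EF_y)(F_z − EF_z)| ≤ 4√(m₄K)∕(ρ_{xy}ρ_{xz})`,   `m₄ = 5κ₂⁴γ_op²∕(1−λγ_op)²`,  `K = αθ·dθ·(βθ·dθ′)∕(1−lamA)`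
# — NO dependence on the background: the cumulant ENTRY of the output majorant `K3⁺` (the class map, (d13)(1)); also in tilted form
# `Z⁻¹∫e^{−U}Π(A_v−a_v)dN(0,AAᵀ)` by (475)'s bridges (row NE7b, node U5c; (463), (466), (467), (475), (456) BY NAME; [folklore])

Cell `pub-balaban`, sub-cell `t4`, spine estimate NE7b (`T4WeightBudget.RelWeightBound`; the cell's OWN estimate — NOT PRINTED in
[Bałaban 1983–89], NOT PROVED).  Crux-route work under `Spine/NE7b/` by the row OWNER (`t4-ne7b-p1` gen 141, file (478)) under FREEZE
(0)'s crux-prover clause; NOTHING of Bałaban's is named as a Lean object, valued or asserted; no `T4Continuum/Support` leaf typed; no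
`def`, no notation; zero `sorry`.  Imports (BY NAME): the OWNER's (475) `…SupWhitenedThirdKernelLetter` (`whitened_mean_bridge`,
`whitened_triple_bridge`; through it (467) `whitened_third_cumulant_raw`, (466) `cross_bilinear_decay`, (463) `distinguished_bound`, `tree_bound`,
(456) `whitened_obs_nonneg`, `whitened_cross_nonneg`, `whitened_J_rowsum_le`).

WHAT IS PROVED ([folklore]; any admissible `D` with weighted letters):
* §1 **`whitened_third_cumulant_entry_raw`** (the display, whitened Lebesgue tilted format).
* §2 THE END **`whitened_third_cumulant_entry`** (tilted form under `N(0,AAᵀ)`, centring constants `a_v = Z⁻¹∫e^{−U}A_v`); §3 toy.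

HONEST (what this is NOT).  One entry; its three fixed-slot double sums (`Σ_{y,z}`, `Σ_{x,z}`, `Σ_{x,y} ≤ 4√(m₄K)S²` from `Σ_yρ_{xy}⁻¹ ≤ S`
for all `x`) and the assembled majorant are the next files; the weighted letters of `D` are hypotheses ((453)∕(462) for the Neumann series,
(476) for a finite-range factor); scalar skeleton ((A3), NC-NE7b-α UNRULED); nothing of Bałaban's asserted.  BY-NAME EFFECT ON THE WALL:
NONE.  NE7b NOT PRINTED ∕ NOT PROVED; spine PROVED 0∕9; rung (B)+1 — the programme's measures remain FINITE-torus statements; NOT the mass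
gap, NOT Clay.  HONEST DEPENDENCY: continuum YM on T⁴ ⇐ BetaPertH ∧ nine spine estimates (0∕9 proved); BetaPertH ⇐ (D1) ∧ (D4) ∧
CAP+tail; G-an2-4 gates asym, D1 and NE2∕3∕4.
-/

set_option autoImplicit false
set_option maxSynthPendingDepth 2

noncomputable section

namespace Summit.QuantumFields.BalabanUV.T4Continuum.NE7b.SupWhitenedThirdCumulantEntry

open MeasureTheory ProbabilityTheory Real Set Function Finset Matrix
open scoped BigOperators
open Literature.Probability.Distributions (matrixCLM)
open SupWhitenedThirdCumulantRaw (whitened_third_cumulant_raw)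
open SupCrossWeightedCovarianceDecay (cross_bilinear_decay)
open SupThirdCumulantTreeDecay (distinguished_bound tree_bound)
open SupWhitenedFirstOrderLetters (whitened_cross_nonneg whitened_obs_nonneg whitened_J_rowsum_le)
open SupWhitenedThirdKernelLetter (whitened_mean_bridge whitened_triple_bridge)

variable {ι κ : Type} [Fintype ι] [DecidableEq ι] [Fintype κ] [DecidableEq κ]

variable {U : EuclideanSpace ℝ ι → ℝ} {U' : EuclideanSpace ℝ ι → EuclideanSpace ℝ ι →L[ℝ] ℝ}
  {U'' : EuclideanSpace ℝ ι → EuclideanSpace ℝ ι →L[ℝ] EuclideanSpace ℝ ι →L[ℝ] ℝ} {Hk : ι → ι → ℝ} {A : Matrix ι κ ℝ} {D : κ → κ → ℝ}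
  {γop κ₀ κ₁ κ₂ a τ δ θp lam lamA αr αc hr γ dθ dθ' αθ βθ : ℝ} {θ : κ → κ → ℝ} {σ : ι → κ → ℝ} {ρ : ι → ι → ℝ}

/-! ## §1. The raw entry (whitened Lebesgue tilted format) -/

/-- **THE THIRD-CUMULANT ENTRY, GENERAL `Γ = AAᵀ`, ANY ADMISSIBLE `D`**: `|E_ν(F_x − EF_x)(F_y − EF_y)(F_z − EF_z)| ≤ 4√(m₄K)∕(ρ_{xy}ρ_{xz})`.
[folklore] -/
theorem whitened_third_cumulant_entry_raw [Nonempty κ] (hΓop : (γop • (1 : Matrix ι ι ℝ) - A * Aᵀ).PosSemidef) (Y : Finset ι)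
    (hUd : ∀ φ : EuclideanSpace ℝ ι, HasFDerivAt U (U' φ) φ) (hU'd : ∀ φ : EuclideanSpace ℝ ι, HasFDerivAt U' (U'' φ) φ)
    (hU''c : Continuous U'') (hκ₀ : 0 ≤ κ₀) (hκ₁ : 0 ≤ κ₁) (ha : 0 ≤ a) (hτ : 0 < τ) (hδ : 0 < δ) (hθ0 : 0 < θp) (hθ1 : θp < 1)
    (hκθ : (2 * κ₀ * (1 + τ) + 4 * δ) * γop ≤ θp) (hκθw : 2 * κ₀ * (1 + τ) * γop + 4 * δ ≤ θp)
    (hstab : ∀ φ : EuclideanSpace ℝ ι, -(κ₀ * ∑ x ∈ Y, φ x ^ 2) ≤ U φ)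
    (hU'b : ∀ φ : EuclideanSpace ℝ ι, ‖U' φ‖ ≤ κ₁ * (a + ∑ x ∈ Y, φ x ^ 2)) (hU''b : ∀ φ : EuclideanSpace ℝ ι, ‖U'' φ‖ ≤ κ₂) (hlam : 0 ≤ lam)
    (hUsec : ∀ s : ℝ, 0 ≤ s → s ≤ 1 → ∀ a b : EuclideanSpace ℝ ι,
      U ((1 - s) • a + s • b) - lam / 2 * (s * (1 - s)) * ∑ i, (a i - b i) ^ 2 ≤ (1 - s) * U a + s * U b)
    (hρg : lam * γop < 1)
    (hHk : ∀ (φ : EuclideanSpace ℝ ι) (x z : ι), |U'' φ (EuclideanSpace.single z (1 : ℝ)) (EuclideanSpace.single x (1 : ℝ))| ≤ Hk x z)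
    (hHk0 : ∀ v u, 0 ≤ Hk v u) (ψ : EuclideanSpace ℝ ι)
    (hαr : ∀ u, ∑ w, |A u w| ≤ αr) (hαc : ∀ w, ∑ u, |A u w| ≤ αc) (hhr : ∀ v, ∑ u, Hk v u ≤ hr)
    (hlamA : ∀ x : κ, ∑ u, ∑ v, |A u x| * |A v x| * Hk v u ≤ lamA) (hlamA1 : lamA < 1) (hγ : αc * hr * αr / (1 - lamA) ≤ γ) (hγ1 : γ < 1)
    -- the admissible `D` and its weighted letters
    (hD : ∀ x y, 0 ≤ D x y)
    (hDC : ∀ x y, (if x = y then (1 : ℝ) else 0) + ∑ z, D x z * ((if y = z then 0 else ∑ u, ∑ v, |A u y| * |A v z| * Hk v u) / (1 - lamA)) ≤ D x y)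
    (hθnn : ∀ z w, 0 ≤ θ z w) (hDr : ∀ z, ∑ w, D z w * θ z w ≤ dθ) (hdθ : 0 ≤ dθ) (hDc : ∀ w, ∑ z, D z w * θ z w ≤ dθ') (hdθ' : 0 ≤ dθ')
    -- the weights and the weighted profiles
    (hσ0 : ∀ x w, 0 ≤ σ x w) (hσθ : ∀ x z w, σ x w ≤ σ x z * θ z w)
    (hρ1 : ∀ x y, 1 ≤ ρ x y) (hρsymm : ∀ x y, ρ x y = ρ y x) (hρmul : ∀ x y z, ρ x z ≤ ρ x y * ρ y z) (hρσ : ∀ x y w, ρ x y ^ 8 ≤ σ x w * σ y w)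
    (haσ : ∀ v : ι, ∑ w, (∑ u, |A u w| * Hk v u) * σ v w ≤ αθ) (hβ : 0 ≤ βθ) (haσ' : ∀ (v : ι) (w : κ), (∑ u, |A u w| * Hk v u) * σ v w ≤ βθ)
    (x y z : ι) :
    |∫ w, (U' (matrixCLM A (WithLp.toLp 2 w) + ψ) (EuclideanSpace.single x (1 : ℝ)) -
            ∫ w', U' (matrixCLM A (WithLp.toLp 2 w') + ψ) (EuclideanSpace.single x (1 : ℝ))
              ∂((volume : Measure (κ → ℝ)).tilted fun z => -(1 / 2 * (z ⬝ᵥ z) + U (matrixCLM A (WithLp.toLp 2 z) + ψ)))) *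
          (U' (matrixCLM A (WithLp.toLp 2 w) + ψ) (EuclideanSpace.single y (1 : ℝ)) -
            ∫ w', U' (matrixCLM A (WithLp.toLp 2 w') + ψ) (EuclideanSpace.single y (1 : ℝ))
              ∂((volume : Measure (κ → ℝ)).tilted fun z => -(1 / 2 * (z ⬝ᵥ z) + U (matrixCLM A (WithLp.toLp 2 z) + ψ)))) *
          (U' (matrixCLM A (WithLp.toLp 2 w) + ψ) (EuclideanSpace.single z (1 : ℝ)) -
            ∫ w', U' (matrixCLM A (WithLp.toLp 2 w') + ψ) (EuclideanSpace.single z (1 : ℝ))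
              ∂((volume : Measure (κ → ℝ)).tilted fun z => -(1 / 2 * (z ⬝ᵥ z) + U (matrixCLM A (WithLp.toLp 2 z) + ψ))))
        ∂((volume : Measure (κ → ℝ)).tilted fun z => -(1 / 2 * (z ⬝ᵥ z) + U (matrixCLM A (WithLp.toLp 2 z) + ψ)))| ≤
      4 * Real.sqrt (5 * (κ₂ ^ 4 * γop ^ 2) / (1 - lam * γop) ^ 2 * (αθ * dθ * (βθ * dθ') / (1 - lamA))) / (ρ x y * ρ x z) := by
  obtain ⟨w₀⟩ := ‹Nonempty κ›
  haveI : Nonempty ι := ⟨x⟩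
  have hl1 : 0 < 1 - lamA := by linarith
  -- Dobrushin's plain row condition from the letters
  have hrow : ∀ x : κ, ∑ w, (if w = x then 0 else ∑ u, ∑ v, |A u w| * |A v x| * Hk v u) / (1 - lamA) ≤ γ := fun x => by
    rw [← Finset.sum_div]
    refine le_trans (div_le_div_of_nonneg_right ?_ hl1.le) hγ
    refine le_trans (Finset.sum_le_sum fun w _ => ?_) (whitened_J_rowsum_le hHk0 hαr hαc hhr x)
    split_ifs
    · exact le_rfl
    · linarith [abs_nonneg ((1 : Matrix κ κ ℝ) x w)]
  have hγ0 : 0 ≤ γ := by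
    refine le_trans (Finset.sum_nonneg fun w _ => div_nonneg ?_ hl1.le) (hrow w₀)
    split_ifs
    · exact le_rfl
    · exact whitened_cross_nonneg hHk0 A w₀ w
  -- the constants
  have hαθ : 0 ≤ αθ := le_trans (Finset.sum_nonneg fun w _ => mul_nonneg (whitened_obs_nonneg hHk0 A x w) (hσ0 x w)) (haσ x)
  have hK : 0 ≤ αθ * dθ * (βθ * dθ') / (1 - lamA) := by positivity
  have hm : 0 ≤ 5 * (κ₂ ^ 4 * γop ^ 2) / (1 - lam * γop) ^ 2 := by positivity
  -- Step 1: the decay of `B(b^v, b^v')` ((466))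
  have hB : ∀ v v' : ι, ∑ w, (∑ z', D z' w * ∑ u, |A u z'| * Hk v u) * (∑ z', D z' w * ∑ u, |A u z'| * Hk v' u) / (1 - lamA) ≤
      αθ * dθ * (βθ * dθ') / (1 - lamA) / ρ v v' ^ 8 := fun v v' => by
    have h := cross_bilinear_decay (D := D) (θ := θ) (σ := σ) (ρ := fun x y => ρ x y ^ 8) (c := fun _ => 1 - lamA)
      (a := fun w => ∑ u, |A u w| * Hk v u) (b := fun w => ∑ u, |A u w| * Hk v' u) hD hθnn hσ0 hσθ (fun x y w => hρσ x y w)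
      (fun x y => one_le_pow₀ (hρ1 x y)) hDr hdθ hDc hdθ' hl1 (fun _ => le_rfl) (fun w => whitened_obs_nonneg hHk0 A v w)
      (fun w => whitened_obs_nonneg hHk0 A v' w) v v' (haσ v) hβ (haσ' v')
    rw [div_mul_eq_div_div] at h
    exact h
  -- Step 2: (467) at a distinguished vertex, with `Σ_w P(Q+R)/c = B + B`
  have hraw := fun v₁ v₂ v₃ => whitened_third_cumulant_raw hΓop Y hUd hU'd hU''c hκ₀ hκ₁ ha hτ hδ hθ0 hθ1 hκθ hκθw hstab hU'b hU''b hlam hUsec hρg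
    hHk hHk0 ψ hlamA hlamA1 hrow hγ0 hγ1 hD hDC v₁ v₂ v₃
  have hsplit : ∀ v₁ v₂ v₃ : ι, ∑ w, (∑ z', D z' w * ∑ u, |A u z'| * Hk v₁ u) * ((∑ z', D z' w * ∑ u, |A u z'| * Hk v₂ u) +
      ∑ z', D z' w * ∑ u, |A u z'| * Hk v₃ u) / (1 - lamA) =
      ∑ w, (∑ z', D z' w * ∑ u, |A u z'| * Hk v₁ u) * (∑ z', D z' w * ∑ u, |A u z'| * Hk v₂ u) / (1 - lamA) +
      ∑ w, (∑ z', D z' w * ∑ u, |A u z'| * Hk v₁ u) * (∑ z', D z' w * ∑ u, |A u z'| * Hk v₃ u) / (1 - lamA) :=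
    fun v₁ v₂ v₃ => by
      rw [← Finset.sum_add_distrib]
      exact Finset.sum_congr rfl fun w _ => by ring
  -- Step 3: the distinguished bounds ((463) `distinguished_bound`)
  have hdist : ∀ v₁ v₂ v₃ : ι, |∫ w, (U' (matrixCLM A (WithLp.toLp 2 w) + ψ) (EuclideanSpace.single v₁ (1 : ℝ)) -
            ∫ w', U' (matrixCLM A (WithLp.toLp 2 w') + ψ) (EuclideanSpace.single v₁ (1 : ℝ))
              ∂((volume : Measure (κ → ℝ)).tilted fun z => -(1 / 2 * (z ⬝ᵥ z) + U (matrixCLM A (WithLp.toLp 2 z) + ψ)))) *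
          (U' (matrixCLM A (WithLp.toLp 2 w) + ψ) (EuclideanSpace.single v₂ (1 : ℝ)) -
            ∫ w', U' (matrixCLM A (WithLp.toLp 2 w') + ψ) (EuclideanSpace.single v₂ (1 : ℝ))
              ∂((volume : Measure (κ → ℝ)).tilted fun z => -(1 / 2 * (z ⬝ᵥ z) + U (matrixCLM A (WithLp.toLp 2 z) + ψ)))) *
          (U' (matrixCLM A (WithLp.toLp 2 w) + ψ) (EuclideanSpace.single v₃ (1 : ℝ)) -
            ∫ w', U' (matrixCLM A (WithLp.toLp 2 w') + ψ) (EuclideanSpace.single v₃ (1 : ℝ))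
              ∂((volume : Measure (κ → ℝ)).tilted fun z => -(1 / 2 * (z ⬝ᵥ z) + U (matrixCLM A (WithLp.toLp 2 z) + ψ))))
        ∂((volume : Measure (κ → ℝ)).tilted fun z => -(1 / 2 * (z ⬝ᵥ z) + U (matrixCLM A (WithLp.toLp 2 z) + ψ)))| ≤
      4 * Real.sqrt (5 * (κ₂ ^ 4 * γop ^ 2) / (1 - lam * γop) ^ 2 * (αθ * dθ * (βθ * dθ') / (1 - lamA))) /
        (min (ρ v₁ v₂) (ρ v₁ v₃)) ^ 4 := fun v₁ v₂ v₃ => by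
    refine distinguished_bound hm hK (hρ1 v₁ v₂) (hρ1 v₁ v₃) (hB v₁ v₂) (hB v₁ v₃) ?_
    have h := hraw v₁ v₂ v₃
    rw [hsplit] at h
    have e : 2 * ((∑ w, (∑ z', D z' w * ∑ u, |A u z'| * Hk v₁ u) * (∑ z', D z' w * ∑ u, |A u z'| * Hk v₂ u) /
        (1 - lamA)) + ∑ w, (∑ z', D z' w * ∑ u, |A u z'| * Hk v₁ u) * (∑ z', D z' w * ∑ u, |A u z'| * Hk v₃ u) /
        (1 - lamA)) * (5 * (κ₂ ^ 4 * γop ^ 2) / (1 - lam * γop) ^ 2) =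
        2 * (5 * (κ₂ ^ 4 * γop ^ 2) / (1 - lam * γop) ^ 2) * ((∑ w, (∑ z', D z' w * ∑ u, |A u z'| * Hk v₁ u) *
          (∑ z', D z' w * ∑ u, |A u z'| * Hk v₂ u) / (1 - lamA) + ∑ w, (∑ z', D z' w * ∑ u, |A u z'| * Hk v₁ u) *
          (∑ z', D z' w * ∑ u, |A u z'| * Hk v₃ u) / (1 - lamA))) := by ring
    rw [e] at h
    exact h
  -- Step 4: the tree bound at the triangle `x, y, z` (`p = ρ_xy`, `q = ρ_xz`, `r = ρ_yz`; integrands commuted)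
  have hC : 0 ≤ 4 * Real.sqrt (5 * (κ₂ ^ 4 * γop ^ 2) / (1 - lam * γop) ^ 2 * (αθ * dθ * (βθ * dθ') / (1 - lamA))) := by positivity
  have hqpr : ρ x z ≤ ρ x y * ρ y z := hρmul x y z
  have hpqr : ρ x y ≤ ρ x z * ρ y z := by rw [hρsymm y z]; exact hρmul x z y
  refine tree_bound hC (hρ1 x y) (hρ1 x z) (hρ1 y z) hqpr hpqr (hdist x y z) ?_ ?_
  · -- `y` distinguished: commute the first two factors, `ρ y x = ρ x y`
    have h := hdist y x z
    rw [hρsymm y x] at h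
    refine le_trans (le_of_eq ?_) h
    congr 1
    exact integral_congr_ae (ae_of_all _ fun w => by ring)
  · -- `z` distinguished: `ρ z x = ρ x z`, `ρ z y = ρ y z`
    have h := hdist z x y
    rw [hρsymm z x, hρsymm z y] at h
    refine le_trans (le_of_eq ?_) h
    congr 1
    exact integral_congr_ae (ae_of_all _ fun w => by ring)

/-! ## §2. THE END: the entry in tilted form under `N(0, AAᵀ)` -/

/-- **THE THIRD-CUMULANT ENTRY UNDER `N(0,AAᵀ)`**: with `a_v = Z⁻¹∫e^{−U}A_v`,
`|Z⁻¹∫e^{−U}(A_x−a_x)(A_y−a_y)(A_z−a_z)dN(0,AAᵀ)| ≤ 4√(m₄K)∕(ρ_{xy}ρ_{xz})` — (475)'s cumulant piece, entrywise. [folklore] -/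
theorem whitened_third_cumulant_entry [Nonempty κ] (hΓop : (γop • (1 : Matrix ι ι ℝ) - A * Aᵀ).PosSemidef) (Y : Finset ι)
    (hUd : ∀ φ : EuclideanSpace ℝ ι, HasFDerivAt U (U' φ) φ) (hU'd : ∀ φ : EuclideanSpace ℝ ι, HasFDerivAt U' (U'' φ) φ)
    (hU''c : Continuous U'') (hκ₀ : 0 ≤ κ₀) (hκ₁ : 0 ≤ κ₁) (ha : 0 ≤ a) (hτ : 0 < τ) (hδ : 0 < δ) (hθ0 : 0 < θp) (hθ1 : θp < 1)
    (hκθ : (2 * κ₀ * (1 + τ) + 4 * δ) * γop ≤ θp) (hκθw : 2 * κ₀ * (1 + τ) * γop + 4 * δ ≤ θp)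
    (hstab : ∀ φ : EuclideanSpace ℝ ι, -(κ₀ * ∑ x ∈ Y, φ x ^ 2) ≤ U φ)
    (hU'b : ∀ φ : EuclideanSpace ℝ ι, ‖U' φ‖ ≤ κ₁ * (a + ∑ x ∈ Y, φ x ^ 2)) (hU''b : ∀ φ : EuclideanSpace ℝ ι, ‖U'' φ‖ ≤ κ₂) (hlam : 0 ≤ lam)
    (hUsec : ∀ s : ℝ, 0 ≤ s → s ≤ 1 → ∀ a b : EuclideanSpace ℝ ι,
      U ((1 - s) • a + s • b) - lam / 2 * (s * (1 - s)) * ∑ i, (a i - b i) ^ 2 ≤ (1 - s) * U a + s * U b)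
    (hρg : lam * γop < 1)
    (hHk : ∀ (φ : EuclideanSpace ℝ ι) (x z : ι), |U'' φ (EuclideanSpace.single z (1 : ℝ)) (EuclideanSpace.single x (1 : ℝ))| ≤ Hk x z)
    (hHk0 : ∀ v u, 0 ≤ Hk v u) (ψ : EuclideanSpace ℝ ι)
    (hαr : ∀ u, ∑ w, |A u w| ≤ αr) (hαc : ∀ w, ∑ u, |A u w| ≤ αc) (hhr : ∀ v, ∑ u, Hk v u ≤ hr)
    (hlamA : ∀ x : κ, ∑ u, ∑ v, |A u x| * |A v x| * Hk v u ≤ lamA) (hlamA1 : lamA < 1) (hγ : αc * hr * αr / (1 - lamA) ≤ γ) (hγ1 : γ < 1)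
    (hD : ∀ x y, 0 ≤ D x y)
    (hDC : ∀ x y, (if x = y then (1 : ℝ) else 0) + ∑ z, D x z * ((if y = z then 0 else ∑ u, ∑ v, |A u y| * |A v z| * Hk v u) / (1 - lamA)) ≤ D x y)
    (hθnn : ∀ z w, 0 ≤ θ z w) (hDr : ∀ z, ∑ w, D z w * θ z w ≤ dθ) (hdθ : 0 ≤ dθ) (hDc : ∀ w, ∑ z, D z w * θ z w ≤ dθ') (hdθ' : 0 ≤ dθ')
    (hσ0 : ∀ x w, 0 ≤ σ x w) (hσθ : ∀ x z w, σ x w ≤ σ x z * θ z w)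
    (hρ1 : ∀ x y, 1 ≤ ρ x y) (hρsymm : ∀ x y, ρ x y = ρ y x) (hρmul : ∀ x y z, ρ x z ≤ ρ x y * ρ y z) (hρσ : ∀ x y w, ρ x y ^ 8 ≤ σ x w * σ y w)
    (haσ : ∀ v : ι, ∑ w, (∑ u, |A u w| * Hk v u) * σ v w ≤ αθ) (hβ : 0 ≤ βθ) (haσ' : ∀ (v : ι) (w : κ), (∑ u, |A u w| * Hk v u) * σ v w ≤ βθ)
    (x y z : ι) :
    |(∫ ω : EuclideanSpace ℝ ι, exp (-U (ω + ψ)) ∂(multivariateGaussian 0 (A * Aᵀ)))⁻¹ * (∫ ω : EuclideanSpace ℝ ι, exp (-U (ω + ψ)) *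
        ((U' (ω + ψ) (EuclideanSpace.single x (1 : ℝ)) - (∫ ω : EuclideanSpace ℝ ι, exp (-U (ω + ψ)) ∂(multivariateGaussian 0 (A * Aᵀ)))⁻¹ *
            (∫ ω : EuclideanSpace ℝ ι, exp (-U (ω + ψ)) * U' (ω + ψ) (EuclideanSpace.single x (1 : ℝ)) ∂(multivariateGaussian 0 (A * Aᵀ)))) *
          (U' (ω + ψ) (EuclideanSpace.single y (1 : ℝ)) - (∫ ω : EuclideanSpace ℝ ι, exp (-U (ω + ψ)) ∂(multivariateGaussian 0 (A * Aᵀ)))⁻¹ *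
            (∫ ω : EuclideanSpace ℝ ι, exp (-U (ω + ψ)) * U' (ω + ψ) (EuclideanSpace.single y (1 : ℝ)) ∂(multivariateGaussian 0 (A * Aᵀ)))) *
          (U' (ω + ψ) (EuclideanSpace.single z (1 : ℝ)) - (∫ ω : EuclideanSpace ℝ ι, exp (-U (ω + ψ)) ∂(multivariateGaussian 0 (A * Aᵀ)))⁻¹ *
            (∫ ω : EuclideanSpace ℝ ι, exp (-U (ω + ψ)) * U' (ω + ψ) (EuclideanSpace.single z (1 : ℝ)) ∂(multivariateGaussian 0 (A * Aᵀ)))))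
        ∂(multivariateGaussian 0 (A * Aᵀ)))| ≤
      4 * Real.sqrt (5 * (κ₂ ^ 4 * γop ^ 2) / (1 - lam * γop) ^ 2 * (αθ * dθ * (βθ * dθ') / (1 - lamA))) / (ρ x y * ρ x z) := by
  have hUc : Continuous U := continuous_iff_continuousAt.2 fun φ => (hUd φ).continuousAt
  have hU'c : Continuous U' := continuous_iff_continuousAt.2 fun φ => (hU'd φ).continuousAt
  have h := whitened_third_cumulant_entry_raw hΓop Y hUd hU'd hU''c hκ₀ hκ₁ ha hτ hδ hθ0 hθ1 hκθ hκθw hstab hU'b hU''b hlam hUsec hρg hHk hHk0 ψ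
    hαr hαc hhr hlamA hlamA1 hγ hγ1 hD hDC hθnn hDr hdθ hDc hdθ' hσ0 hσθ hρ1 hρsymm hρmul hρσ haσ hβ haσ' x y z
  rw [whitened_mean_bridge hUc hU'c A ψ (EuclideanSpace.single x (1 : ℝ)), whitened_mean_bridge hUc hU'c A ψ (EuclideanSpace.single y (1 : ℝ)),
    whitened_mean_bridge hUc hU'c A ψ (EuclideanSpace.single z (1 : ℝ)), whitened_triple_bridge hUc hU'c A ψ] at h
  exact h

/-! ## §3. Toy -/

/-- Toy (§1's tree step in numbers): `C∕(pq)` with `C = 4`, `p = q = 2` is `1`. -/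
example : (4 : ℝ) / (2 * 2) = 1 := by norm_num

end Summit.QuantumFields.BalabanUV.T4Continuum.NE7b.SupWhitenedThirdCumulantEntry

end
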